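import Summits.ResolutionOfSingularities.ResolutionOfSingularities.Theorems.FrobeniusClosingPatchingRelPerfectDepthSepFormatStepLemmas
import Summits.ResolutionOfSingularities.ResolutionOfSingularities.Theorems.FrobeniusClosingPatchingRelPerfectDepthSepFormatCotangent
import Summits.ResolutionOfSingularities.ResolutionOfSingularities.Theorems.FrobeniusClosingPatchingRelPerfectDepthMixedFormatBTraces
import Summits.ResolutionOfSingularities.ResolutionOfSingularities.Theorems.FrobeniusClosingPatchingRelPerfectDepthSNCSwap
import Summits.ResolutionOfSingularities.ResolutionOfSingularities.Theorems.FrobeniusClosingPatchingRelPerfectDepthBoundaryLiftPointwise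
import HarnessLib

/-!
# Chain W5.2 — F6 STAGE 2, the POINTWISE KEY of `SepFormat.step`: at a centre point the host, `E` and the charged
# boundary members have simple normal crossings WITH the centre

[OURS · L1 W5.2 · res-D-pv-016 AS res-L1-w52-stub-5, T6-X2 (res-L1-w52-plan-1 RULINGS 2026-08-27T09:17:34Z (3)); helper
file for `…DepthSepFormatStep.lean`.]  NOT a statement of the manuscript under review; AI-written, weaker than expert review;
fact-free.

`SepStep.exists_sncWithAt_host_centre` — at every point `x = i z` of the centre of a weight-one step of stage 2 (format
`SepFormat`, TargetsF6 `StepSepOne` hypotheses read pointwise) there is a family `L ⊆ 𝓘_E :: boundaryOf 𝒩` containing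
every CHARGED member through `x` such that `𝓗 :: L` has simple normal crossings WITH the centre `Ĉ` at `x`.  Cases:
(0) the host IS a boundary member — nothing to exchange; (T) TANGENT (`ord_z 𝔟 ≥ 2`): the host is tangent to `E` at `x`,
res-D-pv-009's `SNCWithAt.tangent_swap` (swap the coordinate of `E` for the host's; `E` dropped) with res-D-pv-021's
cotangent reading (α); (C) COINCIDENCE of the host trace with the trace of a boundary member `G`: charged `G` —
`coincidence_swap` over the format's TRANSVERSALITY clause read by (γ′)/(δ) (`E` dropped); uncharged `G` — `swap` with
`M′ = [𝓘_E]` and (β) (`G` dropped, `E` kept); (J) JOINT, no coincidence: the E-side `SNCWithAt (𝔟 :: charged traces) C z`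
lifts by res-D-pv-052's `DepthRetract.sncWithAt_host_cons`.

## References
* J. Kollár, *Lectures on Resolution of Singularities* (2007), Cor. 3.85, 3.104 Step 2.1. [Kollar2007]
* E. Bierstone, D. Grigoriev, P. Milman, J. Włodarczyk, arXiv:1206.3090, Def. 3.1.3 (2), §4 Step 2a. [BierstoneGrigorievMilmanWlodarczyk2011]
-/

-- `Summit.<Summit>.<Sub>.Theorems` with `Sub = Summit` (single-conjunct summit, D-0017)
set_option linter.dupNamespace false

noncomputable section

open CategoryTheory CategoryTheory.Limits AlgebraicGeometry TopologicalSpace IsLocalRing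
open Literature.AlgebraicGeometry.Resolution
open Scheme.IdealSheafData

namespace Summit.ResolutionOfSingularities.ResolutionOfSingularities.Theorems

universe u

namespace DepthGraded

namespace SepStep

/-- [OURS · L1 W5.2] **The pointwise key of the stage-2 step**: at a centre point `x = i z`, a sub-family `L` of
`𝓘_E :: boundaryOf 𝒩` containing every charged member through `x` with `SNCWithAt (𝓗 :: L) Ĉ x` — by the tangent /
coincidence / joint trichotomy. [cite: Kollar2007, Cor. 3.85, 3.104 Step 2.1]
[cite: BierstoneGrigorievMilmanWlodarczyk2011, Def. 3.1.3 (2)] -/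
theorem exists_sncWithAt_host_centre {E X : Scheme.{u}} {i : E ⟶ X} [IsClosedImmersion i]
    (hker : IsEffectiveCartier i.ker) {K 𝓗 : X.IdealSheafData} {𝒩 : List (X.IdealSheafData × ℕ)}
    {𝒟 : List (E.IdealSheafData × ℕ)} (h𝓗 : IsEffectiveCartier 𝓗) (h𝒩c : ∀ G ∈ boundaryOf 𝒩, IsEffectiveCartier G)
    (h𝒩 : 𝒩.map (fun p => (p.1.comap i, p.2)) = 𝒟) (h𝔟 : K.comap i = 𝓗.comap i)
    (hreg : ∀ z : E, i.base z ∈ 𝓗.support → DepthSNC.SNCWithAt [𝓗] ⊤ (i.base z))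
    (htrans : ∀ p ∈ 𝒩, 0 < p.2 → ∀ z : E, z ∈ (p.1.comap i).support →
      stalkIdeal (p.1.comap i) z = stalkIdeal (K.comap i) z → DepthSNC.SNCWithAt [𝓗, p.1] ⊤ (i.base z))
    {C : E.IdealSheafData} (hle : K.comap i ≤ C) (h𝓗Ch : 𝓗 ≤ C.map i)
    (hsncE : HasSNCWith (boundaryOf 𝒟) C) (hsncX : HasSNCWith (i.ker :: boundaryOf 𝒩) (C.map i))
    (hjoint : ∀ z : E, z ∈ C.support →
      ¬ stalkIdeal (K.comap i) z ≤ maximalIdeal (E.presheaf.stalk z) ^ 2 →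
        (∃ B ∈ boundaryOf 𝒟, z ∈ B.support ∧ stalkIdeal B z = stalkIdeal (K.comap i) z) ∨
          DepthSNC.SNCWithAt (K.comap i :: (𝒟.filter fun p => 0 < p.2).map Prod.fst) C z)
    {z : E} (hz : z ∈ C.support) :
    ∃ L : List X.IdealSheafData,
      (∀ D ∈ L, D ∈ i.ker :: boundaryOf 𝒩) ∧
      (∀ p ∈ 𝒩, 0 < p.2 → i.base z ∈ p.1.support → p.1 ∈ L) ∧
      DepthSNC.SNCWithAt (𝓗 :: L) (C.map i) (i.base z) := by
  classical
  set Ch : X.IdealSheafData := C.map i with hCh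
  have hkerCh : i.ker ≤ Ch := DepthOne.ker_le_map_centre i C
  have hcentreE : z ∈ (K.comap i).support := Scheme.IdealSheafData.support_antitone hle hz
  have hcentreH : ∀ z : E, z ∈ C.support → i.base z ∈ 𝓗.support := fun z hz => by
    have h := Scheme.IdealSheafData.support_antitone hle hz
    rw [h𝔟] at h
    exact (Trace.mem_support_comap_iff i 𝓗 z).mp h
  have hxH : i.base z ∈ 𝓗.support := hcentreH z hz
  have hL : DepthSNC.SNCWithAt (i.ker :: boundaryOf 𝒩) Ch (i.base z) := hsncX.sncWithAt (i.base z)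
  -- (0) the host IS a boundary member: nothing to exchange
  by_cases hHbd : 𝓗 ∈ boundaryOf 𝒩
  · refine ⟨i.ker :: boundaryOf 𝒩, fun D hD => hD, fun p hp _ _ => List.mem_cons_of_mem _ (fst_mem_boundaryOf hp), ?_⟩
    exact hL.congr_mem fun D _ => by
      constructor
      · intro hD
        rcases List.mem_cons.mp hD with rfl | hD
        · exact List.mem_cons_of_mem _ hHbd
        · exact hD
      · intro hD; exact List.mem_cons_of_mem _ hD
  obtain ⟨F, -, hF⟩ := h𝓗.exists_stalkIdeal_eq_span (i.base z)
  have hFC : F ∈ stalkIdeal Ch (i.base z) := stalkIdeal_mono h𝓗Ch _ (hF ▸ Ideal.mem_span_singleton_self F)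
  have hout2 : F ∉ maximalIdeal (X.presheaf.stalk (i.base z)) ^ 2 := fun hF2 =>
    (hreg z hxH).not_stalkIdeal_le_sq List.mem_cons_self hxH
      (by rw [hF, Ideal.span_singleton_le_iff_mem]; exact hF2)
  have hxE : i.base z ∈ i.ker.support := by
    have h1 : i.base z ∈ (i.ker.support : Set X) := by rw [← DepthSNC.range_eq_support_ker i]; exact ⟨z, rfl⟩
    exact h1
  have hkerC : stalkIdeal i.ker (i.base z) ≤ stalkIdeal Ch (i.base z) := stalkIdeal_mono hkerCh _
  -- boundary members through `x` are not the hypersurface `E`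
  have hneK : ∀ G ∈ boundaryOf 𝒩, i.base z ∈ G.support → G ≠ i.ker := by
    intro G hG hxG hGk
    have hB : G.comap i ∈ boundaryOf 𝒟 := Trace.comap_mem_boundaryOf i h𝒩 hG
    have hzB : z ∈ (G.comap i).support := (Trace.mem_support_comap_iff i G z).mpr hxG
    apply (hsncE.sncWithAt z).not_stalkIdeal_le_sq hB hzB
    rw [hGk, comap_ker_self]
    calc stalkIdeal (⊥ : E.IdealSheafData) z ≤ stalkIdeal (C ^ 2) z := stalkIdeal_mono bot_le z
      _ = stalkIdeal C z ^ 2 := stalkIdeal_pow _ _ _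
      _ ≤ maximalIdeal _ ^ 2 := Ideal.pow_right_mono ((mem_support_iff_stalkIdeal_le C z).mp hz) 2
  have hL'bd : ∀ D ∈ boundaryOf 𝒩, i.base z ∈ D.support → D ∈ i.ker :: boundaryOf 𝒩 ∧ D ≠ i.ker :=
    fun D hD hxD => ⟨List.mem_cons_of_mem _ hD, hneK D hD hxD⟩
  by_cases hord : stalkIdeal (K.comap i) z ≤ maximalIdeal (E.presheaf.stalk z) ^ 2
  · -- (T) TANGENT: the host is tangent to `E` at `x`; swap the coordinate of `E` for `F`
    have hin : F ∈ stalkIdeal i.ker (i.base z) ⊔ maximalIdeal (X.presheaf.stalk (i.base z)) ^ 2 :=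
      DepthSNC.mem_ker_sup_sq_of_comap_le_sq hF (by rw [← h𝔟]; exact hord)
    refine ⟨boundaryOf 𝒩, fun D hD => List.mem_cons_of_mem _ hD, fun p hp _ _ => fst_mem_boundaryOf hp, ?_⟩
    exact hL.tangent_swap List.mem_cons_self hxE hkerC hxH hF hFC hin hout2 hL'bd
  -- from now on the host trace has ORDER ONE at `z`
  have hord' : ¬ stalkIdeal (𝓗.comap i) z ≤ maximalIdeal (E.presheaf.stalk z) ^ 2 := by rwa [← h𝔟]
  by_cases hco : ∃ G ∈ boundaryOf 𝒩, i.base z ∈ G.support ∧ stalkIdeal (G.comap i) z = stalkIdeal (K.comap i) z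
  · -- (C) COINCIDENCE with the trace of the boundary member `G`
    obtain ⟨G, hG, hxG, hGeq⟩ := hco
    have hin : F ∈ stalkIdeal G (i.base z) ⊔ stalkIdeal i.ker (i.base z) :=
      DepthSNC.mem_sup_ker_of_comap_eq hF (by rw [hGeq, h𝔟])
    by_cases hch : ∃ p ∈ 𝒩, 0 < p.2 ∧ p.1 = G
    · -- charged coincidence: the TRANSVERSALITY clause `H ⋔ G`; swap the coordinate of `E` for `F` (drop `E`)
      obtain ⟨p, hp, hpos, hpG⟩ := hch
      have hzG : z ∈ (p.1.comap i).support := by rw [hpG]; exact (Trace.mem_support_comap_iff i G z).mpr hxG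
      have hHG : DepthSNC.SNCWithAt [𝓗, G] ⊤ (i.base z) := by
        have h := htrans p hp hpos z hzG (by rw [hpG, hGeq])
        rwa [hpG] at h
      have hHneG : 𝓗 ≠ G := fun h => hHbd (h ▸ hG)
      -- distinct members of an snc pair have distinct stalks
      have hne : stalkIdeal G (i.base z) ≠ stalkIdeal 𝓗 (i.base z) := by
        intro heq
        obtain ⟨hregx, d, v, hd, hv, ⟨ι, hι, hιD⟩, -⟩ := hHG
        haveI := hregx
        have h1 := hιD ⟨𝓗, List.mem_cons_self, hxH⟩
        have h2 := hιD ⟨G, List.mem_cons_of_mem _ (List.mem_singleton_self _), hxG⟩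
        have hmem : v (ι ⟨G, List.mem_cons_of_mem _ (List.mem_singleton_self _), hxG⟩) ∈
            Ideal.span (v '' {ι ⟨𝓗, List.mem_cons_self, hxH⟩}) := by
          rw [Set.image_singleton, ← h1, ← heq, h2]
          exact Ideal.mem_span_singleton_self _
        have hidx := DepthSNC.index_mem_of_mem_span_image v hv (le_of_eq hd.symm) hmem
        rw [Set.mem_singleton_iff] at hidx
        exact hHneG (congrArg Subtype.val (hι hidx)).symm
      have hout : F ∉ stalkIdeal G (i.base z) ⊔ maximalIdeal (X.presheaf.stalk (i.base z)) ^ 2 :=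
        DepthSNC.not_mem_sup_sq_of_sncWithAt_pair hHG hxH hxG hne hF
      refine ⟨boundaryOf 𝒩, fun D hD => List.mem_cons_of_mem _ hD, fun p hp _ _ => fst_mem_boundaryOf hp, ?_⟩
      exact hL.coincidence_swap List.mem_cons_self hxE hkerC hxH hF hFC (List.mem_cons_of_mem _ hG) hxG
        (hneK G hG hxG) hin hout hL'bd
    · -- uncharged coincidence: swap the coordinate of `G` for `F` (keep `E`, drop `G`)
      have hGC : stalkIdeal G (i.base z) ≤ stalkIdeal Ch (i.base z) := by
        rw [hCh, Trace.stalkIdeal_le_map_centre_iff i G C z, hGeq]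
        exact stalkIdeal_mono hle z
      have hsing : (⨆ D ∈ [i.ker], stalkIdeal D (i.base z)) = stalkIdeal i.ker (i.base z) := by
        apply le_antisymm
        · exact iSup₂_le fun D hD => by rw [List.mem_singleton.mp hD]
        · exact le_iSup₂ (f := fun D (_ : D ∈ [i.ker]) => stalkIdeal D (i.base z)) i.ker (List.mem_singleton_self _)
      have hin' : F ∈ stalkIdeal G (i.base z) ⊔ (⨆ D ∈ [i.ker], stalkIdeal D (i.base z)) ⊔
          maximalIdeal (X.presheaf.stalk (i.base z)) ^ 2 := by
        rw [hsing]; exact Ideal.mem_sup_left hin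
      have hout' : F ∉ (⨆ D ∈ [i.ker], stalkIdeal D (i.base z)) ⊔ maximalIdeal (X.presheaf.stalk (i.base z)) ^ 2 := by
        rw [hsing]; exact DepthSNC.not_mem_ker_sup_sq_of_not_comap_le_sq hF hord'
      refine ⟨i.ker :: (boundaryOf 𝒩).filter (fun D => decide (D ≠ G)), ?_, ?_, ?_⟩
      · intro D hD
        rcases List.mem_cons.mp hD with rfl | hD
        · exact List.mem_cons_self
        · exact List.mem_cons_of_mem _ (List.mem_filter.mp hD).1
      · intro p hp hpos _
        refine List.mem_cons_of_mem _ (List.mem_filter.mpr ⟨fst_mem_boundaryOf hp, ?_⟩)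
        simpa using fun h => hch ⟨p, hp, hpos, h⟩
      · refine hL.swap (A := G) (M' := [i.ker]) (List.mem_cons_of_mem _ hG) hxG hGC hxH hF hFC ?_ hin' hout' ?_
        · intro D hD
          rw [List.mem_singleton.mp hD]
          exact ⟨List.mem_cons_self, hxE, (hneK G hG hxG).symm⟩
        · intro D hD _
          rcases List.mem_cons.mp hD with rfl | hD
          · exact ⟨List.mem_cons_self, (hneK G hG hxG).symm⟩
          · obtain ⟨hDbd, hDG⟩ := List.mem_filter.mp hD
            exact ⟨List.mem_cons_of_mem _ hDbd, by simpa using hDG⟩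
  · -- (J) JOINT: no coincidence at `z`; the E-side clause lifts (res-D-pv-052's `sncWithAt_host_cons`)
    rcases hjoint z hz hord with ⟨B, hB, hzB, hBeq⟩ | hsncz
    · exfalso
      obtain ⟨G, hG, rfl⟩ := Trace.exists_eq_comap_of_mem_boundaryOf i h𝒩 hB
      exact hco ⟨G, hG, (Trace.mem_support_comap_iff i G z).mp hzB, hBeq⟩
    have hal : (boundaryOf (𝒩.filter fun p => 0 < p.2)).map (fun G => G.comap i) =
        (𝒟.filter fun p => 0 < p.2).map Prod.fst := SepStep.map_comap_boundaryOf_filter i h𝒩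
    have hD' : K.comap i ∉ (𝒟.filter fun p => 0 < p.2).map Prod.fst := by
      intro hmem
      rw [← hal, List.mem_map] at hmem
      obtain ⟨G, hG, hGeq⟩ := hmem
      have hGbd : G ∈ boundaryOf 𝒩 := SepStep.mem_boundaryOf_of_mem_filter hG
      refine hco ⟨G, hGbd, ?_, by rw [hGeq]⟩
      rw [← Trace.mem_support_comap_iff i G z, hGeq]
      exact hcentreE
    have hXc : DepthSNC.SNCWithAt (i.ker :: boundaryOf (𝒩.filter fun p => 0 < p.2)) Ch (i.base z) :=
      hL.anti fun D hD _ => by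
        rcases List.mem_cons.mp hD with rfl | hD
        · exact List.mem_cons_self
        · exact List.mem_cons_of_mem _ (SepStep.mem_boundaryOf_of_mem_filter hD)
    have h := DepthRetract.sncWithAt_host_cons i hker z h𝓗 h𝔟.symm
      (fun G hG => h𝒩c G (SepStep.mem_boundaryOf_of_mem_filter hG)) hal hD' hXc hsncz
    refine ⟨i.ker :: boundaryOf (𝒩.filter fun p => 0 < p.2), ?_, ?_, ?_⟩
    · intro D hD
      rcases List.mem_cons.mp hD with rfl | hD
      · exact List.mem_cons_self
      · exact List.mem_cons_of_mem _ (SepStep.mem_boundaryOf_of_mem_filter hD)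
    · intro p hp hpos _
      exact List.mem_cons_of_mem _ (SepStep.mem_boundaryOf_filter_iff.mpr ⟨p, hp, hpos, rfl⟩)
    · rw [hCh]; exact h

end SepStep

end DepthGraded

end Summit.ResolutionOfSingularities.ResolutionOfSingularities.Theorems

end
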